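import Mathlib
import HarnessLib
import HarnessLib.Audit
import Summits.SmoothPoincare4.Statement
import Literature.Topology.FourManifolds.SPC4Wave0

/-!
Route: InterimWave0

CLOSED (closed) 2026-08-15T10:37:48Z by planner-SmoothPoincare4-route-SmoothPoincare4-InterimWave0-0 — reason: route-repair guardrail: legacy M5 carry-over, 0 cruxes, under floor, no thesis or Assembly; sole item stmt-SmoothPoincare4-0033 is the folklore corollary of Freedman 1982 Thm 1.6 whose conditional form is already proved in tree (existsExoti — note: route-repair (cone guardrail, 2026-08-15): CLOSED (closed_as=closed: content superseded by in-tree Literature THEOREMS — no superseding route exists for --by, and exhausted is tenure-only; the census below is the exhausted census). Census. WHAT THE ROUTE WAS: legacy M5 carry-over container for one i. The file is kept as the record of this route; refuted decls are indexed as negative knowledge (`ledger negatives`).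

Carry-over of the interim blast's sorried statements ABOUT SmoothPoincare4 from the interim Wave-0
family file (Statements/SPC4/Wave0.lean; harness21 @ d8f2665). Thesis (to be sharpened by the route
planner, D-0014e): the equivalences/implications these 1 statements assert
(existsExoticFourSphere_iff_not_smoothPoincareConjectureFour) hold and, combined, bear on
SmoothPoincare4. They enter as UNSTAMPED statement items: grounder first (most are cited results ->
named facts in Literature), then refuter, then provers.

UNDER FLOOR: fewer than 2 cruxes remain after retriage (legacy route; D-0019).

Rationale: M5 migration (docs/m5/PLAN.md 2c‴ as amended by D-0014b): no workspace, no THESIS.md; the interim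
decl text is in run/m5/workspaces/ for the operator and quoted in each item's --informal.

Novelty: NOVELTY (retriage 2026-08-14; searched before claiming: `lit search --hybrid "exotic 4-sphere
homeomorphic but not diffeomorphic … Freedman"`, `lit read book:freedman1990-topology-4-manifolds
--grep`, `lit read arxiv:0906.5177 --grep`, `lit frontier SmoothPoincare4 --since 2020`, `lit
bridges SmoothPoincare4 --cross any`, `lean search`). Self-grade: known.
Nearest prior art: the route's single statement, ExistsExoticFourSphere ↔ ¬
SmoothPoincareConjectureFour.{0} — "some smooth 4-manifold is homeomorphic but not diffeomorphic to
S⁴" (the homeomorphism form of SPC4, FreedmanGompfMorrisonWalker2010 = arXiv:0906.5177, §1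
Conjecture 1, p.3) iff "some smooth homotopy 4-sphere is not diffeomorphic to S⁴" (the homotopy
form, Kirby1997 Problem 4.89, whose own remark reads "Σ is homeomorphic to S⁴ [Freedman], so the
conjecture is that S⁴ has only one smooth structure") — is the folklore corollary of Freedman's
4-dimensional topological Poincaré theorem, FreedmanJDG1982 Thm 1.6 (doi:10.4310/jdg/1214437136, J.
Diff. Geom. 17 p.371) = FreedmanQuinnPMS1990 Cor 7.1B (book:freedman1990-topology-4-manifolds p.83,
verbatim "A 4-manifold homotopy equivalent to S⁴ is homeomorphic to S⁴"). In tree the conditional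
form is already a Literature THEOREM,
Literature.Barriers.SmoothPoincare4.existsExoticFourSphere_iff_of_freedman (hF :
Literature.Topology.FourManifolds.nonempty_homeomorph_sphere_four.{0}) in
Literature/Barriers/SmoothPoincare4/TopologicalInvariantsBlind.lean, and Literature/Topology/F  [refs: 10.4310/jdg/1214437136, 0906.5177, book:freedman1990-topology-4-manifolds, arxiv:0906.5177, doi:10.4310/jdg/1214437136, FreedmanGompfMorrisonWalker2010, Kirby1997, FreedmanJDG1982, FreedmanQuinnPMS1990]

Barriers (technique_class: statement-reformulation; topological category; Freedman): BARRIERS (retriage 2026-08-14). technique_class: statement-reformulation; topological category;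
Freedman
- Literature.Barriers.SmoothPoincare4.TopologicalBarrierFour — APPLIES and is NOT evaded: the
barrier states that, relative to Freedman's theorem (FreedmanJDG1982 Thm 1.6 / FreedmanQuinnPMS1990
Cor 7.1B), nothing computed in the topological category separates a homotopy 4-sphere from S⁴, and
it records this very equivalence (existsExoticFourSphere_iff_of_freedman) as the reason SPC4 is
printed in homeomorphism form (arXiv:0906.5177 §1 Conj. 1). The route's item IS that equivalence: it
can move the difficulty between the two printed forms of the target but cannot discharge any of it.
Honest reading: it does not evade; there is no bet — the item is glue/support usable by
negative-side routes that conclude ExistsExoticFourSphere and by positive-side routes stated over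
SmoothPoincareConjectureFour.
- Literature.Barriers.SmoothPoincare4.SmallExoticaBarrier — same "given Freedman's theorem"
reduction pattern (SimplyConnectedRigidityUpTo k ⇒ SPC4 given Thm 1.6); not engaged: the route
proposes no homeomorphism ⇒ diffeomorphism argument at any b₂.
- Literature.Barriers.SmoothPoincare4.StableBarrierFour and
Literature.Barriers.SmoothPoincare4.HCobordismInvariantBarrierFour and
Literature.Barriers.SmoothPoincare4.GaugeSumBarrierFour — not applicable: the route exhibits no
invariant of any kind (S²×S²-stable, h-cobordism, gauge-theoretic or TFT); the overlap with
"topological (field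

History (route lifecycle, newest last):
- 2026-08-15T10:37:48Z · CLOSED closed — route-repair guardrail: legacy M5 carry-over, 0 cruxes, under floor, no thesis or Assembly; sole item stmt-SmoothPoincare4-0033 is the folklore corollary of Freedman 1982 Thm 1.6 whose conditional for (planner-SmoothPoincare4-route-SmoothPoincare4-InterimWave0-0)

sub-problem: SmoothPoincare4 · status: closed(closed) · opened operator:999:2871251 2026-08-13T05:39:12Z · rev 2 · ledger route-SmoothPoincare4-InterimWave0
GENERATED by the gate from the ledger (D-0016/17). Provers cite these decls: `theorem foo : Summit.SmoothPoincare4.SmoothPoincare4.Theses.InterimWave0.<Decl> := …` in Summits/SmoothPoincare4/SmoothPoincare4/Theorems/<Name>.lean.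
-/

namespace Summit.SmoothPoincare4.SmoothPoincare4.Theses.InterimWave0

open scoped BigOperators Topology Manifold Classical MeasureTheory ProbabilityTheory Matrix InnerProductSpace ComplexConjugate ContinuousMap
open Filter Set Function TopologicalSpace MeasureTheory

attribute [summit_statement] _root_.SmoothPoincare4

open Literature.SPC4 Literature.Topology.FourManifolds

/-- item stmt-SmoothPoincare4-0033 · support · rank 2 · closed · moot by None · by operator
why it might fail: Cannot be false: folklore corollary of FreedmanJDG1982 Thm 1.6 (both sides Type 0, genuine IsManifold (𝓡 4) ∞, no junk witness). Formal risk only: as typed no (hF : nonempty_homeomorph_sphere_four.{0}) hypothesis, so (←) IS Freedman's theorem — not closable in-tree; (→) closable now.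
sources: FreedmanJDG1982, Thm 1.6 (doi:10.4310/jdg/1214437136; J. Diff. Geom. 17, p.371 = PDF p.15, verbatim 'If Σ⁴ is a topological 4-manifold homotopy equivalent to the 4-sphere S⁴, then Σ⁴ is homeomorphic to S⁴'), FreedmanQuinnPMS1990, Cor 7.1B (lit: book:freedman1990-topology-4-manifolds p.83, verbatim 'A 4-manifold homotopy equivalent to S^4 is homeomorphic to S^4'), FreedmanGompfMorrisonWalker2010 = arXiv:0906.5177, §1 Conjecture 1.1: homeomorphism form of SPC4 (= ¬ExistsExoticFourSphere), Kirby1997, Problem 4.89 (homotopy form = SmoothPoincareConjectureFour; remark: 'Σ is homeomorphic to S^4 [Freedman]'), Lean (proved, conditional form): Literature.Barriers.SmoothPoincare4.existsExoticFourSphere_iff_of_freedman (Literature/Barriers/SmoothPoincare4/TopologicalInvariantsBlind.lean:132), Lean (named fact): Literature.Topology.FourManifolds.nonempty_homeomorph_sphere_four (Literature/Topology/FourManifolds/SPC4Wave0.lean:94); Literature.Topology.FourManifolds.nonempty_homeomorph_sphere_four_of_freedman1982 (HomotopyS4Freedman.lean)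
**spc4.S02** (equivalence of the two forms of the flag; summits/spc4-neg/SUMMIT.md, Freedman 1982
Thm 1.6). An exotic 4-sphere exists iff SPC4 (in universe `0`) fails: a homotopy 4-sphere is
homeomorphic to `S⁴` by Freedman, and conversely a homeomorphism is a homotopy equivalence and
transports Hausdorffness and second countability. Known (modulo Freedman). [cite: Freedman1982, Thm
1.6]  [interim: Statements/SPC4/Wave0.lean:102
`existsExoticFourSphere_iff_not_smoothPoincareConjectureFour`] -/
@[route_item "route-SmoothPoincare4-InterimWave0"]
def ExistsExoticFourSphereIffNotSmoothPoincareConjectureFour : Prop :=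
  ExistsExoticFourSphere ↔ ¬ SmoothPoincareConjectureFour.{0}

end Summit.SmoothPoincare4.SmoothPoincare4.Theses.InterimWave0
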